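import Literature.Computability.Complexity.KarpCliqueReduction
import Literature.Computability.Complexity.NegCNFTranscoder
import HarnessLib

/-!
# Karp's Main Theorem, problem 3: `CLIQUE` is NP-complete (discharge of `isNPComplete_CLIQUE`)

Sibling proof file of `KarpProblems.lean` (D-0014: the named fact
`Literature.Computability.Complexity.isNPComplete_CLIQUE : Prop := IsNPComplete CLIQUE` stays a
`def`; this file proves `isNPComplete_CLIQUE_holds`). Karp 1972, §4, Main Theorem: the 21 problems,
among them problem 3 CLIQUE, are NP-complete, by `SATISFIABILITY ∝ CLIQUE` and the remark that all
of them are in NP. The tree's proof assembles pieces that are ALREADY in the tree (nothing is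
restated here):

* `isNPComplete_SAT_holds` — `SAT` is NP-complete (Cook–Levin; `NegCNFTranscoder.lean`,
  Arora–Barak Thm. 2.10 (1));
* `KarpClique.SAT_karpReducible_CLIQUE` — Karp's `SATISFIABILITY ∝ CLIQUE` by a polynomial-time
  map (`KarpCliqueReduction.lean`; combinatorial half `KarpCliqueGadget.lean`, tokenizer
  `KarpCliqueTokens.lean`);
* `CLIQUE_mem_NP` — the clique verifier (`KarpCliqueNP.lean`);

by propagation of hardness along reductions (`IsHard.of_reducible_holds`, Arora–Barak Thm. 2.8).
(In its own file, like `KarpMaxCutComplete.lean`, so that the per-problem discharges of Karp's list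
stay independent of one another.)

## References

* R. M. Karp, *Reducibility among combinatorial problems*, in: R. E. Miller, J. W. Thatcher (eds.),
  Complexity of Computer Computations, Plenum 1972, 85–103, §4 Main Theorem, problem 3 (CLIQUE),
  proof: `SATISFIABILITY ∝ CLIQUE`.
* S. Arora, B. Barak, *Computational Complexity: A Modern Approach*, CUP 2009, Thm. 2.8, Thm. 2.10.
-/

namespace Literature.Computability.Complexity

/-- **`CLIQUE` is NP-hard** (Karp 1972, problem 3): `SAT` is NP-complete (`isNPComplete_SAT_holds`)
and `SAT ≤ₚ CLIQUE` (`KarpClique.SAT_karpReducible_CLIQUE`), hardness propagating along the reduction.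
[cite: Karp1972, §4 Main Theorem, problem 3] -/
theorem CLIQUE_isNPHard : IsNPHard CLIQUE :=
  IsHard.of_reducible_holds (IsComplete.isHard isNPComplete_SAT_holds)
    KarpClique.SAT_karpReducible_CLIQUE

/-- **Discharge of `isNPComplete_CLIQUE`** (Karp 1972, Main Theorem, problem 3 of 21): CLIQUE — the
tree's `CLIQUE = (encodingGraph.pairBool encodingNatBool).toLanguage cliqueSet` — is NP-complete:
in `NP` by the clique verifier (`CLIQUE_mem_NP`), NP-hard by `SAT ≤ₚ CLIQUE` (`CLIQUE_isNPHard`).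
[cite: Karp1972, §4 Main Theorem, problem 3] -/
theorem isNPComplete_CLIQUE_holds : isNPComplete_CLIQUE :=
  ⟨CLIQUE_mem_NP, CLIQUE_isNPHard⟩

end Literature.Computability.Complexity
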